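import Summits.QuantumFields.YangMills.Theorems.LuscherReductionTwistedTraceScalingCurvatureAction
import HarnessLib

/-!
# The size hypotheses of brick c1 from the natural cut-offs: `|F_p(U)_c| ≤ √S(U)`, `u₀(U_p) > 0` on `{S < 2}`; a near step `1 − u₀(W_e) ≤ δ` has
# `|vecPart(W_e)_c| ≤ √(2δ)` and `u₀(W_e) ≥ 0`
# (lane B of S-BASE, crux `TwistedTraceScaling` stmt-QuantumFields-20203; covariant reformulation of the Laplace step, blueprint §5–§6)

`…CurvatureStep.abs_plaqCurv_mul_sub_covCurl_le` (brick c1) is stated with componentwise sizes `τ` (step) and `φ` (curvature) and hemisphere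
hypotheses.  On the invariant bulk `{S(U) ≤ σ}` (`…CurvatureAction.actionBulk_invariant`) and for steps in the `δ`-neighbourhood of the identity
(outside of which `…StepLocality` gives the factor `e^{−2βδ}`) these hypotheses hold with `φ = √σ`, `τ = √(2δ)`.
HONEST FRAMING: bookkeeping; femto rung R2b1 (stub of a child of a CONDITIONAL route); not a gap, not Clay.
-/

set_option autoImplicit false

noncomputable section

open scoped Matrix BigOperators
open Literature.MathematicalPhysics.QuantumFieldTheory
open Literature.MathematicalPhysics.QuantumLattice

namespace Summit.QuantumFields.YangMills.Theorems.FemtoTransferGap.TwoLattice.Cov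

open Summit.QuantumFields.YangMills.Theorems.FemtoTransferGap
open Summit.QuantumFields.YangMills.Theorems.FemtoTransferGap.TwoLattice
open Summit.QuantumFields.YangMills.Theorems.FemtoTransferGap.TwoLattice.Stiff

variable {L : ℕ} [NeZero L]

/-! ## §1 Curvature components from the action -/

/-- `Σ_a F_p(U)_a² ≤ S(U)` for every plaquette. [cite: Luscher1983, §3] -/
theorem sum_plaqCurv_sq_le_wilsonAction (U : GaugeConfig 3 L SU2) (p : Plaquette 3 L) :
    ∑ a, vecPart (hol U p) a ^ 2 ≤ wilsonAction su2Rep U := by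
  refine le_trans ?_ (norm_plaqCurv_sq_le_wilsonAction U)
  rw [norm_plaqCurv_sq]
  exact Finset.single_le_sum (f := fun q => ∑ a, vecPart (hol U q) a ^ 2)
    (fun q _ => Finset.sum_nonneg fun a _ => sq_nonneg _) (Finset.mem_univ p)

/-- ★ `|F_p(U)_c| ≤ √S(U)` for every plaquette and colour. [cite: Luscher1983, §3] -/
theorem abs_plaqCurv_le_sqrt_wilsonAction (U : GaugeConfig 3 L SU2) (p : Plaquette 3 L) (c : Fin 3) :
    |vecPart (hol U p) c| ≤ Real.sqrt (wilsonAction su2Rep U) := by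
  have h1 : vecPart (hol U p) c ^ 2 ≤ ∑ a, vecPart (hol U p) a ^ 2 :=
    Finset.single_le_sum (f := fun a => vecPart (hol U p) a ^ 2) (fun a _ => sq_nonneg _) (Finset.mem_univ c)
  have h2 := sum_plaqCurv_sq_le_wilsonAction U p
  rw [← Real.sqrt_sq_eq_abs]
  exact Real.sqrt_le_sqrt (h1.trans h2)

/-- On `{S ≤ σ}` with `σ < 2`: hemisphere and size hypotheses of brick c1 for the holonomies, `u₀(U_p) ≥ 0` and `|F_p(U)_c| ≤ √σ`. [folklore] -/
theorem hol_hypotheses_of_wilsonAction_le (U : GaugeConfig 3 L SU2) {σ : ℝ} (hσ : σ < 2) (hS : wilsonAction su2Rep U ≤ σ)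
    (p : Plaquette 3 L) : 0 ≤ scalarPart (hol U p) ∧ ∀ c, |vecPart (hol U p) c| ≤ Real.sqrt σ :=
  ⟨(scalarPart_hol_pos_of_wilsonAction_lt_two U (lt_of_le_of_lt hS hσ) p).le,
    fun c => (abs_plaqCurv_le_sqrt_wilsonAction U p c).trans (Real.sqrt_le_sqrt hS)⟩

/-! ## §2 Step components from the electric proximity `1 − u₀(W_e) ≤ δ` -/

omit [NeZero L] in
/-- ★ A near step: `1 − u₀(W) ≤ δ ≤ 1` ⇒ `u₀(W) ≥ 0` and `|vecPart(W)_c| ≤ √(2δ)`. [folklore] -/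
theorem step_hypotheses_of_near (W : SU2) {δ : ℝ} (hδ1 : δ ≤ 1) (hnear : 1 - scalarPart W ≤ δ) :
    0 ≤ scalarPart W ∧ ∀ c, |vecPart W c| ≤ Real.sqrt (2 * δ) := by
  refine ⟨by linarith, fun c => ?_⟩
  have h1 : vecPart W c ^ 2 ≤ ∑ a, vecPart W a ^ 2 :=
    Finset.single_le_sum (f := fun a => vecPart W a ^ 2) (fun a _ => sq_nonneg _) (Finset.mem_univ c)
  have h2 := sum_vecPart_sq_le_plaqTerm W
  rw [← Real.sqrt_sq_eq_abs]
  exact Real.sqrt_le_sqrt (by linarith)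

/-- The dichotomy used with `…StepLocality`: either every link of the step is `δ`-near (`1 − u₀(W_e) ≤ δ` for all `e`, so the c1 hypotheses hold with
`τ = √(2δ)`), or some link is far (`δ ≤ 1 − u₀(W_{e₀})`, and the step is suppressed by `e^{−2βδ}`). [folklore] -/
theorem near_or_far (W : GaugeConfig 3 L SU2) (δ : ℝ) :
    (∀ e, 1 - scalarPart (W e) ≤ δ) ∨ ∃ e₀, δ ≤ 1 - scalarPart (W e₀) := by
  by_cases h : ∀ e, 1 - scalarPart (W e) ≤ δ
  · exact Or.inl h
  · obtain ⟨e₀, he⟩ := not_forall.mp h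
    exact Or.inr ⟨e₀, (not_le.mp he).le⟩

end Summit.QuantumFields.YangMills.Theorems.FemtoTransferGap.TwoLattice.Cov

end
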